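import Mathlib
import Literature.NumberTheory.LFunctions.Zhang2022.Section17Eval1710Rel
import Literature.NumberTheory.LFunctions.Zhang2022.TypedSection17Identities
import Literature.NumberTheory.LFunctions.Zhang2022.TypedSection17Rel
import HarnessLib

/-!
# Zhang (2022) §17 (17.2)–(17.6) in the RELATIVE reading below the leaf (17.6)ᴿ: `Step17_u007Rel`,
# `Eq17_5Rel`, the relative window-sum bookkeeping, and the edge `(17.2) + (17.5)ᴿ ⇒ (17.6)ᴿ`

Topic `Literature/NumberTheory/LFunctions/Zhang2022` (Landau–Siegel audit tree; verdict-neutral).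
Y. Zhang, *Discrete mean estimates and the Landau–Siegel zero*, arXiv:2211.02515v1 (2022)
[Zhang2022LandauSiegel] — **an unrefereed manuscript under adjudication. The two `def … : Prop` below are
READINGS of §17 displays (u007, (17.5)) in the relative budget of record (family ruling D-G-L4fam-1),
STATED NOT ASSERTED; nothing here asserts or denies Theorems 1–2 of the source.**

WHY (ZHANG-L WP16, leaf h17_6 = `Typed.Section17.Eq17_6Rel`; numbers). The v19 leaf is ALREADY relative
(`o(𝔓)` read `ε(𝔞+1)𝔓`, TypedSection17Rel p442843), but the tree's edges below it are absolute:
`Phi3Eval.eq17_5_of : Step17_u007 → Step17_u008 → Eq17_5`, `eq17_6_of : Eq17_2 → Eq17_5 → Eq17_6`,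
`eq17_6Rel_of_eq17_6`. The un-printed step u007 (§17 p. 96, tex L4735: "A detailed analysis shows that
(17.2) remains valid if … `κ₂(n₁)` is replaced by `(1∗μ)(n₁)` …") replaces `ν*` by `ν_repl` inside
`pΣ_{n<D⁴}ν*(n)ν(n)/n`; its first-order terms are logarithmic insertions of size `O(α𝓛·𝔞·𝓛^c·p)`
against a main term `𝔢₀𝔞p` (the leaf owner zl-w16-p6's analysis, wp16/zl-w16-p6/NOTES.md [D]:
"crude τ-majorants FAIL (Σ τ_kν/n ~ L′^k) … likely needs the RELATIVE reading (error ε(𝔞+1)p)") — the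
§17 member of the family row G-L4fam-1 («𝔞/L′(1,χ) size under (A)», relative-reading dissolution ADOPTED,
D-G-L4fam-1). This file supplies the relative route so that a relative proof of u007 closes the leaf:

* READINGS `Typed.Section17.Step17_u007Rel c′` (u007 with `o(p)` read `ε(𝔞+1)p`) and
  `Typed.Section17.Eq17_5Rel c′` ((17.5) likewise); weakenings `step17_u007Rel_of_u007`, `eq17_5Rel_of_eq17_5`.
* `Skeleton.window_sum_evalRel` (+ `_beta3`, `_beta2`): the window-sum bookkeeping of
  `SkeletonWindowPowers.window_sum_eval` with the RELATIVE per-modulus error `ε(𝔞+1)p` in and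
  `ε(𝔞+1)𝔓` out (no size input on `𝔞` at all — not even the tree's `𝔞 ≪ 𝓛⁴`).
* EDGES `Phi3Eval.eq17_5Rel_of_u007Rel : Step17_u007Rel c′ → Eq17_5Rel c′` (u008 is the tree theorem
  `step17_u008_holds`) and `Phi3Eval.eq17_6Rel_of_rel : Eq17_2 c′ → Eq17_5Rel c′ → Eq17_6Rel c′`
  (Lemma 17.1 = tree `sum_nu_sq_div_Ico_eventually`; `(pt₀)^{β₃} = −1 + O(α𝓛)` = tree
  `norm_pt0_cpow_beta3_add_one_le`).

So leaf h17_6 ⇐ {`Eq17_2` (contour move ✓ `Eq172.eq17_2a_of_prop22i` p473651 + the Ψ₁→Ψ extension),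
`Step17_u007Rel`}. No instance, no notation; `𝔢₀ = frake0` is e″-free (no RT-05 twin needed).

## References

* Y. Zhang, arXiv:2211.02515v1 (2022), §17 (17.2)–(17.6) pp. 95–96 (tex L4711–L4765); Lemma 17.1.
  [cite: Zhang2022LandauSiegel, §17 (17.5)–(17.6) p.96]
-/

noncomputable section

open Complex Real

namespace Literature.NumberTheory.LFunctions.Zhang2022.Typed.Section17

open Literature.NumberTheory.LFunctions.Zhang2022
open Literature.NumberTheory.LFunctions.Zhang2022.Skeleton

variable (c' : ℝ)

/-- **§17.u007 in the relative reading** (§17 p. 96, tex L4735–L4747): "(17.2) [i.e. (17.3)] remains valid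
if, in the expression for `ν*(n)`, the factor `κ₂(n₁)` is replaced by `(1∗μ)(n₁)`, … `𝔢₀χ(n₂n₃)` …, and
`g̃₂(n₅)`, `g̃₃(n₆)` by `1`" — `Φ₃⁺(p) = pΣ_{n<D⁴}ν_repl(n)ν(n)/n + o((𝔞+1)p)` uniformly in `p ∼ P`
(`Step17_u007` with `o(p)` read `ε(𝔞+1)p`; family ruling D-G-L4fam-1). NOT PRINTED in this form (the
analysis is not carried out in print at all). CLAIM. [cite: Zhang2022LandauSiegel, §17 u007 p.96] -/
def Step17_u007Rel : Prop :=
  ∀ ε : ℝ, 0 < ε → ForAllLarge fun D _ χ => AssumptionA D χ → ∀ p ∈ primeWindow D,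
    ‖Phi3plus c' χ p - (p : ℂ) * ∑ n ∈ Finset.Ico 1 (D ^ 4), nuRepl χ n * nu χ n / (n : ℂ)‖ ≤
      ε * (frakA χ + 1) * p

/-- **(17.5) in the relative reading** (§17 p. 96, tex L4750): "`Φ₃⁺(p) = 𝔢₀pΣ_{n<D⁴}ν(n)²/n + o(p)`" with
`o(p)` read `ε(𝔞+1)p`, uniformly in `p ∼ P` (`𝔢₀ = frake0`). NOT PRINTED in this form (D-G-L4fam-1
reading). CLAIM. [cite: Zhang2022LandauSiegel, §17 (17.5) p.96] -/
def Eq17_5Rel : Prop :=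
  ∀ ε : ℝ, 0 < ε → ForAllLarge fun D _ χ => AssumptionA D χ → ∀ p ∈ primeWindow D,
    ‖Phi3plus c' χ p - frake0 * (p : ℂ) * ∑ n ∈ Finset.Ico 1 (D ^ 4), nu χ n ^ 2 / (n : ℂ)‖ ≤
      ε * (frakA χ + 1) * p

/-- The printed u007 implies its relative reading (`εp ≤ ε(𝔞+1)p`). [cite: Zhang2022LandauSiegel, §17 u007 p.96] -/
theorem step17_u007Rel_of_u007 (h : Step17_u007 c') : Step17_u007Rel c' := by
  intro ε hε
  refine (h ε hε).mono fun D _ χ _ _ hS hA p hp => ?_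
  have e := hS hA p hp
  have hA0 : 0 ≤ frakA χ := frakA_nonneg χ
  have hp0 : (0 : ℝ) ≤ p := Nat.cast_nonneg p
  have : ε * (p : ℝ) ≤ ε * (frakA χ + 1) * p := by nlinarith [mul_nonneg hε.le hp0]
  exact le_trans e this

/-- The printed (17.5) implies its relative reading. [cite: Zhang2022LandauSiegel, §17 (17.5) p.96] -/
theorem eq17_5Rel_of_eq17_5 (h : Eq17_5 c') : Eq17_5Rel c' := by
  intro ε hε
  refine (h ε hε).mono fun D _ χ _ _ hS hA p hp => ?_
  have e := hS hA p hp
  have hA0 : 0 ≤ frakA χ := frakA_nonneg χ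
  have hp0 : (0 : ℝ) ≤ p := Nat.cast_nonneg p
  have : ε * (p : ℝ) ≤ ε * (frakA χ + 1) * p := by nlinarith [mul_nonneg hε.le hp0]
  exact le_trans e this

end Literature.NumberTheory.LFunctions.Zhang2022.Typed.Section17

namespace Literature.NumberTheory.LFunctions.Zhang2022.Skeleton

/-! ## The window-sum bookkeeping with a RELATIVE per-modulus error -/

/-- **Window-sum bookkeeping, relative form.** Weights `w_D(p) = u + O(α𝓛)` on the window, a family
`‖Φ_{D,χ}(p) − c·p·X_{D,χ}‖ ≤ ε(𝔞+1)p` uniformly for `p ∼ P` (every `ε > 0`, eventually), and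
`X_{D,χ} = 𝔞 + o(1)` give `‖Σ_{p∼P} w_D(p)Φ_{D,χ}(p) − u·c·𝔞·𝔓‖ ≤ ε(𝔞+1)𝔓` (every `ε > 0`, eventually)
— the relative twin of `window_sum_eval`; NO upper bound on `𝔞` is used (the `O(α𝓛)·‖c‖·𝔞` term is
`≤ (ε/3)𝔞` once `α𝓛 = π𝓛⁻⁸` is small). [cite: Zhang2022LandauSiegel, §17 (17.6), (17.9)] -/
theorem window_sum_evalRel {w : ℕ → ℕ → ℂ} {u : ℂ} {Cw : ℝ} {D₁ : ℕ}
    (hw : ∀ D : ℕ, D₁ ≤ D → ∀ p ∈ primeWindow D, ‖w D p - u‖ ≤ Cw * (alpha D * ell D))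
    {Φ : (D : ℕ) → DirichletCharacter ℂ D → ℕ → ℂ} {X : (D : ℕ) → DirichletCharacter ℂ D → ℂ}
    {c : ℂ}
    (hΦ : ∀ ε : ℝ, 0 < ε → ForAllLarge fun D _ χ => AssumptionA D χ →
      ∀ p ∈ primeWindow D, ‖Φ D χ p - c * p * X D χ‖ ≤ ε * (frakA χ + 1) * p)
    (hX : ∀ δ : ℝ, 0 < δ → ForAllLarge fun D _ χ => AssumptionA D χ → ‖X D χ - frakA χ‖ ≤ δ) :
    ∀ ε : ℝ, 0 < ε → ForAllLarge fun D _ χ => AssumptionA D χ →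
      ‖∑ p ∈ primeWindow D, w D p * Φ D χ p - u * c * frakA χ * frakP D‖ ≤
        ε * (frakA χ + 1) * frakP D := by
  intro ε hε
  set M : ℝ := ‖u‖ + |Cw| + 1 with hM
  have hM0 : 0 < M := by positivity
  have hε1 : 0 < ε / (3 * M) := by positivity
  have hδ1 : 0 < ε / (3 * M * (‖c‖ + 1)) := by positivity
  obtain ⟨D₂, h2⟩ := (hΦ _ hε1).and (hX _ hδ1)
  -- the third term: `|Cw|·α𝓛·‖c‖ ≤ |Cw|‖c‖·π/𝓛 ≤ ε/3` once `𝓛` is large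
  set K : ℝ := 3 * (|Cw| * ‖c‖ * π) / ε with hK
  obtain ⟨D₃, h3⟩ := exists_nat_forall_le_ell (max 3 (K + 1))
  refine ⟨max (max D₁ D₂) D₃, fun D _ χ hD hq hprim hA => ?_⟩
  have hD1 : D₁ ≤ D := le_trans (le_trans (le_max_left _ _) (le_max_left _ _)) hD
  have hD2 : D₂ ≤ D := le_trans (le_trans (le_max_right _ _) (le_max_left _ _)) hD
  have hD3 : D₃ ≤ D := le_trans (le_max_right _ _) hD
  have hℓ3 : 3 ≤ ell D := le_trans (le_max_left _ _) (h3 D hD3)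
  have hℓK : K + 1 ≤ ell D := le_trans (le_max_right _ _) (h3 D hD3)
  have hℓ0 : 0 < ell D := by linarith
  have hαℓ0 : 0 ≤ alpha D * ell D := mul_nonneg (alpha_pos' hℓ0).le hℓ0.le
  have hαℓ1 : alpha D * ell D ≤ 1 := alpha_mul_ell_le_one (by linarith)
  have hA0 : 0 ≤ frakA χ := frakA_nonneg χ
  obtain ⟨eΦ, eX⟩ := h2 D χ hD2 hq hprim
  have eΦ' : ∀ p ∈ primeWindow D, ‖Φ D χ p - c * p * X D χ‖ ≤ (ε / (3 * M) * (frakA χ + 1)) * p := by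
    intro p hp
    have := eΦ hA p hp
    simpa only [mul_assoc] using this
  have key := norm_window_sum_sub_le (w D) (Φ D χ) u c (X D χ) (frakA χ)
    (ε / (3 * M) * (frakA χ + 1)) (ε / (3 * M * (‖c‖ + 1))) (Cw * (alpha D * ell D))
    (hw D hD1) eΦ' (eX hA)
  refine key.trans ?_
  rw [show ε * (frakA χ + 1) * frakP D = (ε * (frakA χ + 1)) * frakP D by ring]
  refine mul_le_mul_of_nonneg_right ?_ (frakP_nonneg D)
  -- sizes
  have hη : Cw * (alpha D * ell D) ≤ |Cw| := by
    calc Cw * (alpha D * ell D) ≤ |Cw| * (alpha D * ell D) :=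
          mul_le_mul_of_nonneg_right (le_abs_self _) hαℓ0
      _ ≤ |Cw| * 1 := mul_le_mul_of_nonneg_left hαℓ1 (abs_nonneg _)
      _ = |Cw| := mul_one _
  have huη : ‖u‖ + Cw * (alpha D * ell D) ≤ M := by rw [hM]; linarith
  -- term 1: `(‖u‖+η)·(ε/(3M))·(𝔞+1) ≤ (ε/3)(𝔞+1)`
  have t1 : (‖u‖ + Cw * (alpha D * ell D)) * (ε / (3 * M) * (frakA χ + 1)) ≤ ε / 3 * (frakA χ + 1) := by
    have h1 : (‖u‖ + Cw * (alpha D * ell D)) * (ε / (3 * M)) ≤ ε / 3 := by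
      calc (‖u‖ + Cw * (alpha D * ell D)) * (ε / (3 * M)) ≤ M * (ε / (3 * M)) :=
            mul_le_mul_of_nonneg_right huη hε1.le
        _ = ε / 3 := by field_simp
    have hA1 : 0 ≤ frakA χ + 1 := by linarith
    calc (‖u‖ + Cw * (alpha D * ell D)) * (ε / (3 * M) * (frakA χ + 1))
        = ((‖u‖ + Cw * (alpha D * ell D)) * (ε / (3 * M))) * (frakA χ + 1) := by ring
      _ ≤ ε / 3 * (frakA χ + 1) := mul_le_mul_of_nonneg_right h1 hA1
  -- term 2: `≤ ε/3`
  have t2 : (‖u‖ + Cw * (alpha D * ell D)) * ‖c‖ * (ε / (3 * M * (‖c‖ + 1))) ≤ ε / 3 := by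
    have hc1 : ‖c‖ ≤ ‖c‖ + 1 := by linarith
    calc (‖u‖ + Cw * (alpha D * ell D)) * ‖c‖ * (ε / (3 * M * (‖c‖ + 1)))
        ≤ M * (‖c‖ + 1) * (ε / (3 * M * (‖c‖ + 1))) := by
          refine mul_le_mul_of_nonneg_right ?_ hδ1.le
          exact mul_le_mul huη hc1 (norm_nonneg _) hM0.le
      _ = ε / 3 := by field_simp
  -- term 3: `η‖c‖𝔞 ≤ (ε/3)𝔞`
  have t3 : Cw * (alpha D * ell D) * ‖c‖ * |frakA χ| ≤ ε / 3 * frakA χ := by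
    rw [abs_of_nonneg hA0]
    have hαℓπ : alpha D * ell D ≤ π / ell D := by
      have e : alpha D * ell D = π / ell D ^ 8 := by
        rw [alpha, log_bigP D]; field_simp
      rw [e]
      apply div_le_div_of_nonneg_left Real.pi_pos.le hℓ0
      calc ell D = ell D ^ 1 := (pow_one _).symm
        _ ≤ ell D ^ 8 := pow_le_pow_right₀ (by linarith) (by norm_num)
    have hK' : |Cw| * ‖c‖ * π ≤ ε / 3 * ell D := by
      have e : |Cw| * ‖c‖ * π = ε / 3 * K := by rw [hK]; field_simp
      rw [e]
      exact mul_le_mul_of_nonneg_left (by linarith) (by positivity)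
    have hcoef : Cw * (alpha D * ell D) * ‖c‖ ≤ ε / 3 := by
      calc Cw * (alpha D * ell D) * ‖c‖ ≤ |Cw| * (alpha D * ell D) * ‖c‖ :=
            mul_le_mul_of_nonneg_right (mul_le_mul_of_nonneg_right (le_abs_self _) hαℓ0) (norm_nonneg _)
        _ ≤ |Cw| * (π / ell D) * ‖c‖ :=
            mul_le_mul_of_nonneg_right (mul_le_mul_of_nonneg_left hαℓπ (abs_nonneg _)) (norm_nonneg _)
        _ = (|Cw| * ‖c‖ * π) / ell D := by ring
        _ ≤ (ε / 3 * ell D) / ell D := by gcongr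
        _ = ε / 3 := by field_simp
    exact mul_le_mul_of_nonneg_right hcoef hA0
  nlinarith [t1, t2, t3, hA0]

/-- **`Σ_{p∼P}(pt₀)^{β₃}Φ(p) = −c·𝔞·𝔓 + o((𝔞+1)𝔓)`** from `Φ(p) = c·p·X + o((𝔞+1)p)` on the window and
`X = 𝔞 + o(1)` — relative twin of `window_sum_eval_beta3` (the (17.6) step).
[cite: Zhang2022LandauSiegel, §17 (17.6)] -/
theorem window_sum_evalRel_beta3 (c' : ℝ)
    {Φ : (D : ℕ) → DirichletCharacter ℂ D → ℕ → ℂ} {X : (D : ℕ) → DirichletCharacter ℂ D → ℂ}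
    {c : ℂ}
    (hΦ : ∀ ε : ℝ, 0 < ε → ForAllLarge fun D _ χ => AssumptionA D χ →
      ∀ p ∈ primeWindow D, ‖Φ D χ p - c * p * X D χ‖ ≤ ε * (frakA χ + 1) * p)
    (hX : ∀ δ : ℝ, 0 < δ → ForAllLarge fun D _ χ => AssumptionA D χ → ‖X D χ - frakA χ‖ ≤ δ) :
    ∀ ε : ℝ, 0 < ε → ForAllLarge fun D _ χ => AssumptionA D χ →
      ‖∑ p ∈ primeWindow D, (((p : ℝ) * t0 D : ℝ) : ℂ) ^ beta3 c' D * Φ D χ p +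
          c * frakA χ * frakP D‖ ≤ ε * (frakA χ + 1) * frakP D := by
  obtain ⟨D₁, h1⟩ := exists_nat_forall_le_ell 2
  have hw : ∀ D : ℕ, D₁ ≤ D → ∀ p ∈ primeWindow D,
      ‖(((p : ℝ) * t0 D : ℝ) : ℂ) ^ beta3 c' D - (-1)‖ ≤
        3 * (520 + |c'| * (π + 520)) * (alpha D * ell D) := fun D hD p hp => by
    rw [sub_neg_eq_add]; exact norm_pt0_cpow_beta3_add_one_le c' (h1 D hD) hp
  intro ε hε
  refine (window_sum_evalRel hw hΦ hX ε hε).mono fun D _ χ _ _ h hA => ?_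
  have := h hA
  rwa [show (-1 : ℂ) * c * frakA χ * frakP D = -(c * frakA χ * frakP D) by ring,
    sub_neg_eq_add] at this

/-- **`Σ_{p∼P}(pt₀)^{β₂}Φ(p) = c·𝔞·𝔓 + o((𝔞+1)𝔓)`** likewise — relative twin of `window_sum_eval_beta2`
(the (17.9) step, with `c = 𝔢₁`). [cite: Zhang2022LandauSiegel, §17 (17.9)] -/
theorem window_sum_evalRel_beta2 (c' : ℝ)
    {Φ : (D : ℕ) → DirichletCharacter ℂ D → ℕ → ℂ} {X : (D : ℕ) → DirichletCharacter ℂ D → ℂ}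
    {c : ℂ}
    (hΦ : ∀ ε : ℝ, 0 < ε → ForAllLarge fun D _ χ => AssumptionA D χ →
      ∀ p ∈ primeWindow D, ‖Φ D χ p - c * p * X D χ‖ ≤ ε * (frakA χ + 1) * p)
    (hX : ∀ δ : ℝ, 0 < δ → ForAllLarge fun D _ χ => AssumptionA D χ → ‖X D χ - frakA χ‖ ≤ δ) :
    ∀ ε : ℝ, 0 < ε → ForAllLarge fun D _ χ => AssumptionA D χ →
      ‖∑ p ∈ primeWindow D, (((p : ℝ) * t0 D : ℝ) : ℂ) ^ beta2 c' D * Φ D χ p -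
          c * frakA χ * frakP D‖ ≤ ε * (frakA χ + 1) * frakP D := by
  obtain ⟨D₁, h1⟩ := exists_nat_forall_le_ell 2
  have hw : ∀ D : ℕ, D₁ ≤ D → ∀ p ∈ primeWindow D,
      ‖(((p : ℝ) * t0 D : ℝ) : ℂ) ^ beta2 c' D - 1‖ ≤
        2 * (520 + |c'| * (π + 520)) * (alpha D * ell D) := fun D hD p hp =>
    norm_pt0_cpow_beta2_sub_one_le c' (h1 D hD) hp
  intro ε hε
  refine (window_sum_evalRel hw hΦ hX ε hε).mono fun D _ χ _ _ h hA => ?_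
  have := h hA
  rwa [one_mul] at this

end Literature.NumberTheory.LFunctions.Zhang2022.Skeleton

namespace Literature.NumberTheory.LFunctions.Zhang2022.Phi3Eval

open Literature.NumberTheory.LFunctions.Zhang2022
open Literature.NumberTheory.LFunctions.Zhang2022.Skeleton
open Literature.NumberTheory.LFunctions.Zhang2022.Typed.Section17

/-! ## The relative edges below (17.6)ᴿ -/

/-- **(17.5)ᴿ from u007ᴿ** (u008 `1∗μ∗χ∗χ∗υ∗1∗1 = ν` is the tree theorem `step17_u008_holds`; the
substitution `Σ ν_repl·ν/n = 𝔢₀Σν²/n` is exact, so the relative error is carried unchanged) — relative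
twin of `eq17_5_of`. [cite: Zhang2022LandauSiegel, §17 (17.5) p.96] -/
theorem eq17_5Rel_of_u007Rel {c' : ℝ} (h7 : Step17_u007Rel c') : Eq17_5Rel c' := by
  intro ε hε
  obtain ⟨D₀, h⟩ := h7 ε hε
  refine ⟨D₀, fun D _ χ hD hq hp hA p hpw => ?_⟩
  have key : ∑ n ∈ Finset.Ico 1 (D ^ 4), nuRepl χ n * nu χ n / (n : ℂ) =
      frake0 * ∑ n ∈ Finset.Ico 1 (D ^ 4), nu χ n ^ 2 / (n : ℂ) := by
    rw [Finset.mul_sum]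
    refine Finset.sum_congr rfl fun n hn => ?_
    rw [nuRepl_eq_frake0_mul, step17_u008_holds (χ := χ) n (Finset.mem_Ico.mp hn).1]
    ring
  have := h D χ hD hq hp hA p hpw
  rwa [key, show (p : ℂ) * (frake0 * ∑ n ∈ Finset.Ico 1 (D ^ 4), nu χ n ^ 2 / (n : ℂ)) =
    frake0 * (p : ℂ) * ∑ n ∈ Finset.Ico 1 (D ^ 4), nu χ n ^ 2 / (n : ℂ) by ring] at this

/-- **(17.6)ᴿ from (17.2) and (17.5)ᴿ** — the leaf `Typed.Section17.Eq17_6Rel c′` from the two displays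
below it: (17.2) (contour move + `Ψ₁ → Ψ` extension, absolute `o(𝔓)`) and (17.5) in the relative
reading; Lemma 17.1 and `(pt₀)^{β₃} = −1 + O(α𝓛)` are tree theorems (`sum_nu_sq_div_Ico_eventually`,
`window_sum_evalRel_beta3`). Relative twin of `eq17_6_of`. [cite: Zhang2022LandauSiegel, §17 (17.6) p.96] -/
theorem eq17_6Rel_of_rel {c' : ℝ} (h2 : Eq17_2 c') (h5 : Eq17_5Rel c') : Eq17_6Rel c' := by
  have key := window_sum_evalRel_beta3 c' (Φ := fun D χ p => Phi3plus c' χ p)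
    (X := fun D χ => ∑ n ∈ Finset.Ico 1 (D ^ 4), nu χ n ^ 2 / (n : ℂ)) (c := frake0)
    h5 sum_nu_sq_div_Ico_eventually
  intro ε hε
  have hε2 : 0 < ε / 2 := by positivity
  refine ((h2 _ hε2).and (key _ hε2)).mono fun D _ χ _ _ h hA => ?_
  obtain ⟨e2, e6⟩ := h
  have a := e2 hA
  have b := e6 hA
  beta_reduce at b
  have hA0 : 0 ≤ frakA χ := frakA_nonneg χ
  have hP0 : 0 ≤ frakP D := frakP_nonneg D
  set X : ℂ := ∑ x ∈ finsetOf (PsiOne χ),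
    (((x.p : ℝ) * t0 D : ℝ) : ℂ) ^ beta3 c' D * I4 c' χ x (alpha D) with hX
  set Y : ℂ := ∑ p ∈ primeWindow D, (((p : ℝ) * t0 D : ℝ) : ℂ) ^ beta3 c' D * Phi3plus c' χ p
    with hY
  have a' : ‖X - Y‖ ≤ ε / 2 * (frakA χ + 1) * frakP D := by
    refine le_trans a ?_
    nlinarith [mul_nonneg (mul_nonneg hε2.le hA0) hP0]
  calc ‖X + frake0 * frakA χ * frakP D‖
      = ‖(X - Y) + (Y + frake0 * frakA χ * frakP D)‖ := by ring_nf
    _ ≤ ‖X - Y‖ + ‖Y + frake0 * frakA χ * frakP D‖ := norm_add_le _ _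
    _ ≤ ε / 2 * (frakA χ + 1) * frakP D + ε / 2 * (frakA χ + 1) * frakP D := add_le_add a' b
    _ = ε * (frakA χ + 1) * frakP D := by ring

/-- **Leaf h17_6 from its two open inputs**: `Eq17_2 c′ → Step17_u007Rel c′ → Eq17_6Rel c′`.
[cite: Zhang2022LandauSiegel, §17 (17.6) p.96] -/
theorem eq17_6Rel_of_eq17_2_u007Rel {c' : ℝ} (h2 : Eq17_2 c') (h7 : Step17_u007Rel c') :
    Eq17_6Rel c' :=
  eq17_6Rel_of_rel h2 (eq17_5Rel_of_u007Rel h7)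

end Literature.NumberTheory.LFunctions.Zhang2022.Phi3Eval
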